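import Mathlib
import Literature.NumberTheory.LFunctions.Zhang2022.SkeletonAssembly
import HarnessLib

/-!
# Zhang (2022), typed statements of §2, block B: Assumption (A) through `𝔠*(ρ,ψ) ∈ ℝ`
# (PDF pp. 5–8, displays (2.6)–(2.14) and the un-numbered claims between them)

Topic `Literature/NumberTheory/LFunctions/Zhang2022` (Landau–Siegel audit tree; verdict-neutral).
Y. Zhang, *Discrete mean estimates and the Landau–Siegel zero*, arXiv:2211.02515v1 (2022)
[Zhang2022LandauSiegel] — **an unrefereed manuscript under adjudication. Nothing in this file
asserts or denies its Theorems 1–2.** Campaign D-0069 (statement typing, layer L1), slice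
`plan/L1/ASSIGNMENTS.md` row L1-t2 = TeX lines 345–478 of the arXiv source = PDF pp. 5–8: from
**Assumption (A)** to "By (2.11) and (2.12) we have `𝔠*(ρ,ψ) ∈ ℝ`" (just before Lemma 2.3).

Every displayed or in-line CLAIM of that stretch is a named `def … : Prop` below (STATED, NOT
ASSERTED), in the vocabulary of the banked skeleton (`Skeleton*` files of this directory), unless
the skeleton or the tree already types it — then the table points to the existing declaration and
nothing is restated. Where the tree already PROVES a claim, a `…_holds` theorem discharges the node
here (kernel-checked, no new facts); where the manuscript's claim silently uses a later
proposition (Prop. 2.2), the deduction is a kernel-checked EDGE `…_of_prop22…`.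

| DAG node | locator | printed item | Lean |
|---|---|---|---|
| `Z22:AssA`, `Z22:§2.u010` | p.5, tex L345–347 | Assumption (A) `L(1,χ) < 𝓛⁻²⁰²²` | `Skeleton.AssumptionA` (banked) |
| `Z22:(2.6)` | p.5, (2.6), tex L363 | `P = exp{𝓛⁹}` | `Skeleton.bigP` (banked) |
| `Z22:§2.u011` | p.6, tex L367 | `p ∼ P` for `P < p < P(1+𝓛⁻⁶⁸)`; `Ψ` | `Skeleton.primeWindow`, `Skeleton.Chr` (banked) |
| `Z22:(2.7)` | p.6, (2.7), tex L371 | `Ω` | `Skeleton.Omega` (banked) |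
| `Z22:(2.8)` | p.6, (2.8), tex L375 | `𝓛₁ = 𝓛⁴⁰⁵`, `s₀ = ½ + 2πit₀`, `t₀ = 𝓛⁵¹⁹` | `Skeleton.ell1`, `Skeleton.s0`, `Skeleton.t0` (banked) |
| `Z22:(2.9)` | p.6, (2.9), tex L380 | `𝔓 := Σ_{p∼P} p = (1+o(1))P²𝓛⁻⁷⁷` | object `Zhang2022.frakP` (tree), `Skeleton.frakP_eq_sum_primeWindow`; CLAIM `Eq29` — DISCHARGED `eq29_holds` (tree `Zhang2022.frakP_bounds`) |
| `Z22:Prop2.1`, `Z22:§2.u012` | p.6, tex L386–389 | Proposition 2.1 | `Skeleton.Prop21` (banked; edge `Skeleton.prop21_of_lemmas`) |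
| `Z22:§2.u013` | p.6, tex L396 | average gap `≃ 2π/log(Dp²t₀²) = α(1+O(α𝓛))` | CLAIM `GapParam` (the identity); "≃ average gap" is heuristic prose (noted) |
| `Z22:(2.10)` | p.6, (2.10), tex L400 | `α = π/log P` | `Skeleton.alpha` (banked) |
| `Z22:Prop2.2` | p.6, tex L406–421 | Proposition 2.2 (i), (ii), (iii) | `Skeleton.Prop22i/ii/iii`, `Skeleton.Prop22` (banked) |
| `Z22:§2.u014` | p.6, tex L420 | (iii) "of the form `α + O(α²𝓛)`" | CLAIM `Prop22iiiBigO` (+ bridges to the banked restated form `Skeleton.Prop22iii c′`) |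
| `Z22:§2.u015` | p.7, tex L437 | `Z(s,ψ)` analytic, non-vanishing on `t > 0`; `Y(s,ψ)² = Z(s,ψ)⁻¹` | CLAIM `ZfacUpper` — DISCHARGED `zfacUpper_holds`; object `Skeleton.Yroot` + `Skeleton.Yroot_spec` (banked; existence = tree `GammaFactor.exists_sqrt_inv_Zfac`) |
| `Z22:§2.u016` | p.7, tex L441 | `M(s,ψ) = Y(s,ψ)L(s,ψ)` | `Skeleton.Mfun` (banked) |
| `Z22:§2.u017` | p.7, tex L444 | `M(s₁,ψ)M(s₂,ψ)`, `M(s₁,ψ)/M(s₂,ψ)` independent of the choice `±Y` | CLAIM `YSignIndep` — DISCHARGED `ySignIndep_holds` (tree `GammaFactor.sqrt_inv_Zfac_eq_or_eq_neg`) |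
| `Z22:§2.u018` | p.7, tex L448 | `M(s,ψ) = Y(s,ψ)⁻¹L(1−s,ψ̄)` | CLAIM `MReflect` — DISCHARGED `mReflect_holds` (tree `GammaFactor.sqrt_inv_Zfac_mul_LFunction`) |
| (in-line) | p.7, tex L450 | "`|Y(1/2+it,ψ)| = 1`" | CLAIM `NormYHalf` — DISCHARGED `normYHalf_holds` (tree `GammaFactor.norm_sqrt_inv_Zfac_half_eq_one`) |
| `Z22:§2.u019` | p.7, tex L452 | `|M(1/2+it,ψ)| = |L(1/2+it,ψ)|` | CLAIM `NormMHalf` — DISCHARGED `normMHalf_holds` (tree `GammaFactor.norm_M_half_eq`) |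
| `Z22:(2.11)` | p.7, (2.11), tex L455 | `M(1/2+it,ψ) ∈ ℝ` | CLAIM `Eq211` — DISCHARGED `eq211_holds` (tree `GammaFactor.M_half_im_eq_zero`) |
| `Z22:(2.12)` | p.7, (2.12), tex L459 | `iM′(1/2+it,ψ) ∈ ℝ` | CLAIM `Eq212` — DISCHARGED `eq212_holds` (tree `GammaFactor.I_mul_deriv_M_half_im_eq_zero`) |
| `Z22:§2.u020` | p.7, tex L464 | restated gap assertion `|γ′ − γ − α| < c′α²𝓛` | `Skeleton.Prop22iii c′` (banked) |
| `Z22:(2.13)` | p.7, (2.13), tex L468 | `β₁, β₂, β₃` | `Skeleton.beta1/2/3` (banked) |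
| `Z22:(2.14)` | p.8, (2.14), tex L471 | `𝔷(ψ)`; "(this is slightly smaller than `Ω`)" | `Skeleton.zeroSet` (banked); PROVED `zeroRegion_subset_Omega` (and tree `Skeleton.mem_prodZeroSetOmega_of_mem_zeroSet`) |
| `Z22:§2.u021` | p.8, tex L473 | `M′(ρ,ψ) = Y(ρ,ψ)L′(ρ,ψ) ≠ 0` for `ρ ∈ 𝔷(ψ)` | CLAIM `DerivMAtZero`; EDGE `derivMAtZero_of_prop22ii` (⇐ `Skeleton.Prop22ii`; tree `GammaFactor.deriv_M_eq_of_LFunction_eq_zero` / `deriv_M_ne_zero_of_simple_zero`) |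
| `Z22:§2.u022` | p.8, tex L474 | `𝔠*(ρ,ψ) = −iM(ρ+β₁)M(ρ+β₂)M(ρ+β₃)/M′(ρ)` | `Skeleton.cstar` (banked) |
| `Z22:§2.u023` | p.8, tex L478 | "By (2.11) and (2.12) we have `𝔠*(ρ,ψ) ∈ ℝ`" | CLAIM `CstarReal c′`; EDGE `cstarReal_of_prop22i` (⇐ `Skeleton.Prop22i`, the silent use of `β = ½`; tree `GammaFactor.calCstar_im_eq_zero`); `cstarReal_of_lemma23` |

Conventions (skeleton INTERFACE §3): standing quantifier `Skeleton.ForAllLarge`; "`X ≪ Y`" ↦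
`∃ C, … X ≤ C·Y`; "`(1 + o(1))`" ↦ `∀ ε > 0, eventually |X − Y| ≤ εY`; norms for `|·|`; `ψ̄ = ψ⁻¹`
(Mathlib's inverse character; its `LFunction` is `L(s,ψ̄)`), as in the tree's
`GammaFactor.LFunction_eq_Zfac_mul`. The claims of p. 7 about `M` and `Y` are made for "`ψ ∈ Ψ`",
i.e. for every member `x : Skeleton.Chr D` (prime `p ∼ P`, primitive `ψ (mod p)`), with no
largeness of `D` needed; the claims of p. 8 are made "in what follows we assume `ψ ∈ Ψ₁`" and for
`ρ ∈ 𝔷(ψ)`, under the standing quantifier.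

## References

* Y. Zhang, arXiv:2211.02515v1 (2022), §2 pp. 5–8, Assumption (A), (2.6)–(2.14), Props. 2.1–2.2.
  [cite: Zhang2022LandauSiegel, §2 pp. 5–8]
* H. Davenport, *Multiplicative Number Theory*, 2nd ed., GTM 74 (1980), Ch. 9 (functional
  equation; consumed only through the tree's `Zhang2022.GammaFactor.*`). [cite: DavenportMNT1980, Ch. 9]
-/

noncomputable section

open Complex Real ComplexConjugate

namespace Literature.NumberTheory.LFunctions.Zhang2022.Section2

open Literature.NumberTheory.LFunctions.Zhang2022.Skeleton

/-! ## (2.9): `𝔓 = (1 + o(1))P²𝓛⁻⁷⁷` -/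

/-- **(2.9)** (p. 6): "Note that `𝔓 := Σ_{p∼P} p = (1 + o(1))P²𝓛⁻⁷⁷`." The definition half is the
tree's object `Zhang2022.frakP` (`= Σ_{p ∈ primeWindow D} p`, `Skeleton.frakP_eq_sum_primeWindow`);
the CLAIM half, typed per the `(1 + o(1))` convention: for every `ε > 0`, for all large `D`,
`|𝔓 − P²𝓛⁻⁷⁷| ≤ ε·P²𝓛⁻⁷⁷`. DAG `Z22:(2.9)`. DISCHARGED below (`eq29_holds`).
[cite: Zhang2022LandauSiegel, §2 (2.9) p.6] -/
def Eq29 : Prop :=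
  ∀ ε : ℝ, 0 < ε → ∃ D₀ : ℕ, ∀ D : ℕ, D₀ ≤ D →
    |frakP D - bigP D ^ 2 * (ell D ^ 77)⁻¹| ≤ ε * (bigP D ^ 2 * (ell D ^ 77)⁻¹)

/-- **(2.9) holds**: the tree's `Zhang2022.frakP_bounds` gives `|𝔓 − P²𝓛⁻⁷⁷| ≤ 3𝓛⁻⁶⁸·P²𝓛⁻⁷⁷`
for all large `D`, and `3𝓛⁻⁶⁸ ≤ ε` once `log D ≥ 3/ε + 1`. [cite: Zhang2022LandauSiegel, §2 (2.9) p.6] -/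
theorem eq29_holds : Eq29 := by
  intro ε hε
  obtain ⟨D₀, hD₀⟩ := frakP_bounds
  refine ⟨max D₀ ⌈Real.exp (3 / ε + 1)⌉₊, fun D hD => ?_⟩
  have hD0 : D₀ ≤ D := le_trans (le_max_left _ _) hD
  have hD1 : ⌈Real.exp (3 / ε + 1)⌉₊ ≤ D := le_trans (le_max_right _ _) hD
  have hlog : 3 / ε + 1 ≤ Real.log D := by
    have h : Real.exp (3 / ε + 1) ≤ D := le_trans (Nat.le_ceil _) (by exact_mod_cast hD1)
    exact (Real.le_log_iff_exp_le (lt_of_lt_of_le (Real.exp_pos _) h)).mpr h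
  have hε3 : 0 < 3 / ε := div_pos (by norm_num) hε
  have hℓ1 : 1 ≤ Real.log D := by linarith
  have hℓpos : 0 < Real.log D := by linarith
  have hℓ68 : 3 / ε ≤ Real.log D ^ 68 :=
    calc 3 / ε ≤ Real.log D := by linarith
      _ = Real.log D ^ 1 := (pow_one _).symm
      _ ≤ Real.log D ^ 68 := pow_le_pow_right₀ hℓ1 (by norm_num)
  have hpow : 0 < Real.log D ^ 68 := pow_pos hℓpos 68
  have hcoef : 3 * (Real.log D ^ 68)⁻¹ ≤ ε := by
    rw [← div_eq_mul_inv, div_le_iff₀ hpow]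
    calc (3 : ℝ) = ε * (3 / ε) := by field_simp
      _ ≤ ε * Real.log D ^ 68 := by gcongr
  have key : |frakP D - bigP D ^ 2 * (ell D ^ 77)⁻¹| ≤
      3 * (Real.log D ^ 68)⁻¹ * (bigP D ^ 2 * (ell D ^ 77)⁻¹) := hD₀ D hD0
  have hX : 0 ≤ bigP D ^ 2 * (ell D ^ 77)⁻¹ := by
    have : 0 < ell D := hℓpos
    positivity
  exact key.trans (mul_le_mul_of_nonneg_right hcoef hX)

/-- `Eq29` — `_holds` alias of `eq29_holds` above under the fact's exact name (appended
2026-08-28, D-0026 bookkeeping: the proof term is the existing theorem of this file; no statement,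
definition or attribute is edited; no new named fact; the ledger's debt table listed the fact
unproved). [cite: Zhang2022LandauSiegel, §2 (2.9) p.6] -/
theorem _root_.Literature.NumberTheory.LFunctions.Zhang2022.Section2.Eq29_holds : Eq29 :=
  _root_.Literature.NumberTheory.LFunctions.Zhang2022.Section2.eq29_holds

/-! ## p. 6: the average-gap parameter identity and Proposition 2.2 (iii) as printed -/

/-- **p. 6, after Proposition 2.1** (DAG `Z22:§2.u013`): "For `ψ (mod p) ∈ Ψ`, the average gap between
consecutive zeros of `L(s,ψ)L(s,ψχ)` in `Ω` is `≃ 2π/log(Dp²t₀²) = α(1 + O(α𝓛))`", `α = π/log P`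
(2.10). Typed: the parameter identity `2π/log(Dp²t₀²) = α(1 + O(α𝓛))`, uniformly for `p ∼ P` —
`|2π/log(Dp²t₀²) − α| ≤ C·α·(α𝓛)` for all large `D`. (The words "the average gap … is ≃" are a
zero-density heuristic, not a claim consumed later; noted, not typed.) CLAIM.
[cite: Zhang2022LandauSiegel, §2 p.6 (before (2.10))] -/
def GapParam : Prop :=
  ∃ C : ℝ, ∃ D₀ : ℕ, ∀ D : ℕ, D₀ ≤ D → ∀ p ∈ primeWindow D,
    |2 * π / Real.log ((D : ℝ) * (p : ℝ) ^ 2 * t0 D ^ 2) - alpha D| ≤ C * alpha D ^ 2 * ell D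

/-- **Proposition 2.2 (iii) as printed on p. 6** (DAG `Z22:§2.u014`): for `ψ ∈ Ψ₁`, "the gap between
any consecutive zeros of `L(s,ψ)L(s,ψχ)` in `Ω` is of the form `α + O(α²𝓛)`" — i.e. for SOME
absolute constant the restated form of p. 7 holds. The skeleton types the restated form with the
constant as a parameter (`Skeleton.Prop22iii c′`: "`|γ′ − γ − α| < c′α²𝓛` for some (large) constant
`c′ > 0`", DAG `Z22:§2.u020`); the printed `O`-form is its existential closure. CLAIM.
[cite: Zhang2022LandauSiegel, §2 Prop. 2.2 (iii) p.6] -/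
def Prop22iiiBigO : Prop := ∃ c' : ℝ, 0 < c' ∧ Prop22iii c'

/-- The restated gap assertion (p. 7) for a constant `c′ > 0` gives the printed `O`-form (p. 6).
[cite: Zhang2022LandauSiegel, §2 p.7 (restated (iii))] -/
theorem prop22iiiBigO_of_prop22iii {c' : ℝ} (hc' : 0 < c') (h : Prop22iii c') : Prop22iiiBigO :=
  ⟨c', hc', h⟩

/-- The restated gap assertion is monotone in `c′` (a larger constant is weaker), so the `O`-form
yields `Skeleton.Prop22iii c″` for every `c″` at least the witness; in particular the witness may be
taken "large". [cite: Zhang2022LandauSiegel, §2 p.7 (restated (iii))] -/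
theorem prop22iii_mono {c' c'' : ℝ} (hle : c' ≤ c'') (h : Prop22iii c') : Prop22iii c'' := by
  obtain ⟨D₀, hD₀⟩ := h
  refine ⟨D₀, fun D _ χ hD hq hp x hx s hs s' hs' hlt hcons => ?_⟩
  have key := hD₀ D χ hD hq hp x hx s hs s' hs' hlt hcons
  have hnn : 0 ≤ alpha D ^ 2 * ell D := by
    have hℓ : 0 ≤ ell D := Real.log_natCast_nonneg D
    positivity
  calc |s'.im - s.im - alpha D| < c' * alpha D ^ 2 * ell D := key
    _ ≤ c'' * alpha D ^ 2 * ell D := by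
      rw [mul_assoc, mul_assoc]; exact mul_le_mul_of_nonneg_right hle hnn

/-! ## p. 7: `Z`, `Y`, `M` on the upper half-plane ("Assume `ψ ∈ Ψ`") -/

/-- **p. 7** (DAG `Z22:§2.u015`, the premise): "On the upper-half plane, since `Z(s,ψ)` is analytic and
non-vanishing, there is an analytic function `Y(s,ψ)` such that `Y(s,ψ)² = Z(s,ψ)⁻¹`." The premise
as a CLAIM: `Z(·,ψ)` (the tree's `GammaFactor.Zfac`) is complex-differentiable and zero-free at every
`s` with `Im s > 0`, for every `ψ ∈ Ψ`. The conclusion (existence of `Y`) is the tree's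
`GammaFactor.exists_sqrt_inv_Zfac`, and the skeleton's object `Skeleton.Yroot` is such a `Y`
(`Skeleton.Yroot_spec`). DISCHARGED below. [cite: Zhang2022LandauSiegel, §2 p.7] -/
def ZfacUpper : Prop :=
  ∀ (D : ℕ) (x : Chr D) (s : ℂ), 0 < s.im →
    DifferentiableAt ℂ (GammaFactor.Zfac x.ψ) s ∧ GammaFactor.Zfac x.ψ s ≠ 0

/-- `Z(s,ψ)` is analytic and non-vanishing on the upper half-plane — the tree's
`GammaFactor.differentiableAt_Zfac` and `GammaFactor.Zfac_ne_zero`. [cite: Zhang2022LandauSiegel, §2 p.7] -/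
theorem zfacUpper_holds : ZfacUpper := fun _ x _ hs =>
  ⟨GammaFactor.differentiableAt_Zfac x.ψ hs, GammaFactor.Zfac_ne_zero x.prim hs⟩

/-- `ZfacUpper` — `_holds` alias of `zfacUpper_holds` above under the fact's exact name (appended
2026-08-28, D-0026 bookkeeping: the proof term is the existing theorem of this file; no statement,
definition or attribute is edited; no new named fact; the ledger's debt table listed the fact
unproved). [cite: Zhang2022LandauSiegel, §2 p.7] -/
theorem _root_.Literature.NumberTheory.LFunctions.Zhang2022.Section2.ZfacUpper_holds : ZfacUpper :=
  _root_.Literature.NumberTheory.LFunctions.Zhang2022.Section2.zfacUpper_holds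

/-- **p. 7** (DAG `Z22:§2.u017`): "for each `ψ`, there are two choices of `M(s,ψ)` up to `±`, but the
expressions `M(s₁,ψ)M(s₂,ψ)` and `M(s₁,ψ)/M(s₂,ψ)` are independent of these choices": for any two
analytic square roots `Y₁, Y₂` of `Z(·,ψ)⁻¹` on the upper half-plane and `Mⱼ = YⱼL(·,ψ)`, the
products `M(s₁)M(s₂)` and quotients `M(s₁)/M(s₂)` (`Im s₁, Im s₂ > 0`) agree. CLAIM — DISCHARGED
below. [cite: Zhang2022LandauSiegel, §2 p.7] -/
def YSignIndep : Prop :=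
  ∀ (D : ℕ) (x : Chr D) (Y₁ Y₂ : ℂ → ℂ),
    DifferentiableOn ℂ Y₁ {s : ℂ | 0 < s.im} → DifferentiableOn ℂ Y₂ {s : ℂ | 0 < s.im} →
    (∀ s : ℂ, 0 < s.im → Y₁ s ^ 2 = (GammaFactor.Zfac x.ψ s)⁻¹) →
    (∀ s : ℂ, 0 < s.im → Y₂ s ^ 2 = (GammaFactor.Zfac x.ψ s)⁻¹) →
    ∀ s₁ s₂ : ℂ, 0 < s₁.im → 0 < s₂.im →
      Y₁ s₁ * x.ψ.LFunction s₁ * (Y₁ s₂ * x.ψ.LFunction s₂) =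
          Y₂ s₁ * x.ψ.LFunction s₁ * (Y₂ s₂ * x.ψ.LFunction s₂) ∧
        Y₁ s₁ * x.ψ.LFunction s₁ / (Y₁ s₂ * x.ψ.LFunction s₂) =
          Y₂ s₁ * x.ψ.LFunction s₁ / (Y₂ s₂ * x.ψ.LFunction s₂)

/-- The sign-independence claim of p. 7 holds: two analytic square roots of `Z(·,ψ)⁻¹` on the
(connected) upper half-plane agree up to a global sign (tree
`GammaFactor.sqrt_inv_Zfac_eq_or_eq_neg`), and a global sign cancels in `M(s₁)M(s₂)` and in
`M(s₁)/M(s₂)`. [cite: Zhang2022LandauSiegel, §2 p.7] -/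
theorem ySignIndep_holds : YSignIndep := by
  intro D x Y₁ Y₂ h₁ h₂ hY₁ hY₂ s₁ s₂ hs₁ hs₂
  rcases GammaFactor.sqrt_inv_Zfac_eq_or_eq_neg x.prim h₁ h₂ hY₁ hY₂ with h | h
  · rw [h hs₁, h hs₂]
    exact ⟨rfl, rfl⟩
  · rw [h hs₁, h hs₂]
    simp only [Pi.neg_apply]
    constructor
    · ring
    · rw [neg_mul, neg_mul, neg_div_neg_eq]

/-- `YSignIndep` — `_holds` alias of `ySignIndep_holds` above under the fact's exact name (appended
2026-08-28, D-0026 bookkeeping: the proof term is the existing theorem of this file; no statement,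
definition or attribute is edited; no new named fact; the ledger's debt table listed the fact
unproved). [cite: Zhang2022LandauSiegel, §2 p.7] -/
theorem _root_.Literature.NumberTheory.LFunctions.Zhang2022.Section2.YSignIndep_holds :
    YSignIndep :=
  _root_.Literature.NumberTheory.LFunctions.Zhang2022.Section2.ySignIndep_holds

/-- **p. 7** (DAG `Z22:§2.u018`): "The functional equation (2.2) gives `M(s,ψ) = Y(s,ψ)⁻¹L(1−s,ψ̄)`"
(on `t > 0`, where `M` is defined; `ψ̄ = ψ⁻¹`). CLAIM — DISCHARGED below.
[cite: Zhang2022LandauSiegel, §2 p.7] -/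
def MReflect : Prop :=
  ∀ (D : ℕ) (x : Chr D) (s : ℂ), 0 < s.im →
    Mfun x.ψ s = (Yroot x.ψ s)⁻¹ * x.ψ⁻¹.LFunction (1 - s)

/-- `M(s,ψ) = Y(s,ψ)⁻¹L(1−s,ψ̄)` on the upper half-plane — the tree's
`GammaFactor.sqrt_inv_Zfac_mul_LFunction` ((2.2) divided by `Y`). [cite: Zhang2022LandauSiegel, §2 p.7] -/
theorem mReflect_holds : MReflect := fun _ x s hs =>
  GammaFactor.sqrt_inv_Zfac_mul_LFunction x.prim x.p_ne_one (ne_of_gt hs)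
    ((Yroot_spec x.prim).2 s hs)

/-- `MReflect` — `_holds` alias of `mReflect_holds` above under the fact's exact name (appended
2026-08-28, D-0026 bookkeeping: the proof term is the existing theorem of this file; no statement,
definition or attribute is edited; no new named fact; the ledger's debt table listed the fact
unproved). [cite: Zhang2022LandauSiegel, §2 p.7] -/
theorem _root_.Literature.NumberTheory.LFunctions.Zhang2022.Section2.MReflect_holds : MReflect :=
  _root_.Literature.NumberTheory.LFunctions.Zhang2022.Section2.mReflect_holds

/-- The imaginary part of `1/2 + it` is `t`. [folklore] -/
private theorem im_half_add (t : ℝ) : ((1 / 2 : ℂ) + t * I).im = t := by simp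

/-- **p. 7, in-line**: "Since `|Y(1/2+it,ψ)| = 1` …" (`t > 0`). CLAIM — DISCHARGED below.
[cite: Zhang2022LandauSiegel, §2 p.7] -/
def NormYHalf : Prop :=
  ∀ (D : ℕ) (x : Chr D) (t : ℝ), 0 < t → ‖Yroot x.ψ (1 / 2 + t * I)‖ = 1

/-- `|Y(1/2+it,ψ)| = 1` for `t > 0` — the tree's `GammaFactor.norm_sqrt_inv_Zfac_half_eq_one`
(`|Z(1/2+it,ψ)| = 1`). [cite: Zhang2022LandauSiegel, §2 p.7] -/
theorem normYHalf_holds : NormYHalf := fun _ x _ ht =>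
  GammaFactor.norm_sqrt_inv_Zfac_half_eq_one x.prim (Yroot_spec x.prim).2 ht

/-- `NormYHalf` — `_holds` alias of `normYHalf_holds` above under the fact's exact name (appended
2026-08-28, D-0026 bookkeeping: the proof term is the existing theorem of this file; no statement,
definition or attribute is edited; no new named fact; the ledger's debt table listed the fact
unproved). [cite: Zhang2022LandauSiegel, §2 p.7] -/
theorem _root_.Literature.NumberTheory.LFunctions.Zhang2022.Section2.NormYHalf_holds : NormYHalf :=
  _root_.Literature.NumberTheory.LFunctions.Zhang2022.Section2.normYHalf_holds

/-- **p. 7** (DAG `Z22:§2.u019`): "it follows that `|M(1/2+it,ψ)| = |L(1/2+it,ψ)|`" (`t > 0`).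
CLAIM — DISCHARGED below. [cite: Zhang2022LandauSiegel, §2 p.7] -/
def NormMHalf : Prop :=
  ∀ (D : ℕ) (x : Chr D) (t : ℝ), 0 < t →
    ‖Mfun x.ψ (1 / 2 + t * I)‖ = ‖x.ψ.LFunction (1 / 2 + t * I)‖

/-- `|M(1/2+it,ψ)| = |L(1/2+it,ψ)|` — the tree's `GammaFactor.norm_M_half_eq`.
[cite: Zhang2022LandauSiegel, §2 p.7] -/
theorem normMHalf_holds : NormMHalf := fun _ x t ht =>
  GammaFactor.norm_M_half_eq x.prim ht
    ((Yroot_spec x.prim).2 _ (by rw [im_half_add]; exact ht))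

/-- `NormMHalf` — `_holds` alias of `normMHalf_holds` above under the fact's exact name (appended
2026-08-28, D-0026 bookkeeping: the proof term is the existing theorem of this file; no statement,
definition or attribute is edited; no new named fact; the ledger's debt table listed the fact
unproved). [cite: Zhang2022LandauSiegel, §2 p.7] -/
theorem _root_.Literature.NumberTheory.LFunctions.Zhang2022.Section2.NormMHalf_holds : NormMHalf :=
  _root_.Literature.NumberTheory.LFunctions.Zhang2022.Section2.normMHalf_holds

/-- **(2.11)** (p. 7, DAG `Z22:(2.11)`): "`M(1/2+it,ψ) ∈ ℝ`" (`t > 0`), typed as `Im M(1/2+it,ψ) = 0`.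
CLAIM — DISCHARGED below. [cite: Zhang2022LandauSiegel, §2 (2.11) p.7] -/
def Eq211 : Prop :=
  ∀ (D : ℕ) (x : Chr D) (t : ℝ), 0 < t → (Mfun x.ψ (1 / 2 + t * I)).im = 0

/-- **(2.11) holds** — the tree's `GammaFactor.M_half_im_eq_zero` (`M(½+it)² = |L(½+it)|² ≥ 0`).
[cite: Zhang2022LandauSiegel, §2 (2.11) p.7] -/
theorem eq211_holds : Eq211 := fun _ x t ht =>
  GammaFactor.M_half_im_eq_zero x.prim x.p_ne_one ht
    ((Yroot_spec x.prim).2 _ (by rw [im_half_add]; exact ht))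

/-- `Eq211` — `_holds` alias of `eq211_holds` above under the fact's exact name (appended
2026-08-28, D-0026 bookkeeping: the proof term is the existing theorem of this file; no statement,
definition or attribute is edited; no new named fact; the ledger's debt table listed the fact
unproved). [cite: Zhang2022LandauSiegel, §2 (2.11) p.7] -/
theorem _root_.Literature.NumberTheory.LFunctions.Zhang2022.Section2.Eq211_holds : Eq211 :=
  _root_.Literature.NumberTheory.LFunctions.Zhang2022.Section2.eq211_holds

/-- **(2.12)** (p. 7, DAG `Z22:(2.12)`): "and, consequently, `iM′(1/2+it,ψ) ∈ ℝ`" (`t > 0`), typed as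
`Im (i·M′(1/2+it,ψ)) = 0` with `M′` the complex derivative of `M(·,ψ)`. CLAIM — DISCHARGED below.
[cite: Zhang2022LandauSiegel, §2 (2.12) p.7] -/
def Eq212 : Prop :=
  ∀ (D : ℕ) (x : Chr D) (t : ℝ), 0 < t → (I * deriv (Mfun x.ψ) (1 / 2 + t * I)).im = 0

/-- **(2.12) holds** — the tree's `GammaFactor.I_mul_deriv_M_half_im_eq_zero` (differentiate the
real function `u ↦ M(½+iu)` of (2.11)). [cite: Zhang2022LandauSiegel, §2 (2.12) p.7] -/
theorem eq212_holds : Eq212 := fun _ x _ ht =>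
  GammaFactor.I_mul_deriv_M_half_im_eq_zero x.prim x.p_ne_one (Yroot_spec x.prim).1
    (Yroot_spec x.prim).2 ht

/-- `Eq212` — `_holds` alias of `eq212_holds` above under the fact's exact name (appended
2026-08-28, D-0026 bookkeeping: the proof term is the existing theorem of this file; no statement,
definition or attribute is edited; no new named fact; the ledger's debt table listed the fact
unproved). [cite: Zhang2022LandauSiegel, §2 (2.12) p.7] -/
theorem _root_.Literature.NumberTheory.LFunctions.Zhang2022.Section2.Eq212_holds : Eq212 :=
  _root_.Literature.NumberTheory.LFunctions.Zhang2022.Section2.eq212_holds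

/-! ## p. 8: `𝔷(ψ)`, `M′(ρ,ψ) ≠ 0`, `𝔠*(ρ,ψ) ∈ ℝ` ("In what follows we assume `ψ ∈ Ψ₁`") -/

/-- **(2.14), the parenthesis "(this is slightly smaller than `Ω`)"** (p. 8): the region
`|σ − 1/2| < 1/2`, `|t − 2πt₀| < 𝓛₁` of (2.14) is contained in `Ω` (2.7) (`Re s₀ = ½`, `Im s₀ = 2πt₀`,
`𝓛₁ < 𝓛₁ + 2`). PROVED (for the zero set itself see the tree's
`Skeleton.mem_prodZeroSetOmega_of_mem_zeroSet`). [cite: Zhang2022LandauSiegel, §2 (2.14) p.8] -/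
theorem zeroRegion_subset_Omega (D : ℕ) :
    {s : ℂ | |s.re - 1 / 2| < 1 / 2 ∧ |s.im - 2 * π * t0 D| < ell1 D} ⊆ Omega D := by
  rintro s ⟨hre, him⟩
  refine ⟨?_, ?_⟩
  · rw [Complex.sub_re, s0_re]; exact hre
  · rw [Complex.sub_im, s0_im]; exact lt_of_lt_of_le him (by linarith)

/-- `𝔷(ψ)` (2.14) lies in the region of (2.14), hence in `Ω`. [cite: Zhang2022LandauSiegel, §2 (2.14) p.8] -/
theorem mem_Omega_of_mem_zeroSet {D : ℕ} {x : Chr D} {ρ : ℂ} (h : ρ ∈ zeroSet D x) :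
    ρ ∈ Omega D :=
  zeroRegion_subset_Omega D ⟨h.1, h.2.1⟩

/-- **p. 8** (DAG `Z22:§2.u021`): "Assume `ρ ∈ 𝔷(ψ)`. Note that `M′(ρ,ψ) = Y(ρ,ψ)L′(ρ,ψ) ≠ 0`"
(for `ψ ∈ Ψ₁`, the standing assumption of p. 8). Both the identity and the non-vanishing, under the
standing quantifier. CLAIM; the non-vanishing silently uses the simplicity of the zeros
(Proposition 2.2 (ii)) — see the EDGE `derivMAtZero_of_prop22ii`.
[cite: Zhang2022LandauSiegel, §2 p.8] -/
def DerivMAtZero : Prop :=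
  ForAllLarge fun D _ χ => ∀ x ∈ PsiOne χ, ∀ ρ ∈ zeroSet D x,
    deriv (Mfun x.ψ) ρ = Yroot x.ψ ρ * deriv x.ψ.LFunction ρ ∧ deriv (Mfun x.ψ) ρ ≠ 0

/-- The identity half of `Z22:§2.u021` holds outright: at a zero `ρ` of `L(·,ψ)` with `Im ρ > 0`,
`M′(ρ,ψ) = Y(ρ,ψ)L′(ρ,ψ)` (product rule; tree `GammaFactor.deriv_M_eq_of_LFunction_eq_zero`), for
every `D ≥ 3` and every `ψ ∈ Ψ`. [cite: Zhang2022LandauSiegel, §2 p.8] -/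
theorem deriv_Mfun_eq_of_mem_zeroSet {D : ℕ} (hD : 3 ≤ D) {x : Chr D} {ρ : ℂ}
    (h : ρ ∈ zeroSet D x) :
    deriv (Mfun x.ψ) ρ = Yroot x.ψ ρ * deriv x.ψ.LFunction ρ :=
  GammaFactor.deriv_M_eq_of_LFunction_eq_zero x.ψ_ne_one (Yroot_spec x.prim).1
    (im_pos_of_mem_zeroSet hD h) h.2.2

/-- A simple zero of `L(s,ψ)L(s,ψχ)` at a zero `ρ` of `L(·,ψ)` forces `L′(ρ,ψ) ≠ 0`
(`(fg)′(ρ) = f′(ρ)g(ρ)` when `f(ρ) = 0`). [folklore] -/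
private theorem deriv_LFunction_ne_zero_of_simple {D : ℕ} [NeZero D] (χ : DirichletCharacter ℂ D)
    {x : Chr D} {ρ : ℂ} (hρ1 : ρ ≠ 1) (hL : x.ψ.LFunction ρ = 0)
    (hsimple : deriv (fun w => x.ψ.LFunction w * (psiChi χ x).LFunction w) ρ ≠ 0) :
    deriv x.ψ.LFunction ρ ≠ 0 := by
  intro hd
  apply hsimple
  have hf : DifferentiableAt ℂ x.ψ.LFunction ρ :=
    DirichletCharacter.differentiableAt_LFunction x.ψ ρ (Or.inl hρ1)
  have hg : DifferentiableAt ℂ (psiChi χ x).LFunction ρ :=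
    DirichletCharacter.differentiableAt_LFunction (psiChi χ x) ρ (Or.inl hρ1)
  have h := (hf.hasDerivAt.mul hg.hasDerivAt).deriv
  change deriv (x.ψ.LFunction * (psiChi χ x).LFunction) ρ = 0
  rw [h, hd, hL, zero_mul, zero_mul, add_zero]

/-- **EDGE** `Prop. 2.2 (ii) ⇒ Z22:§2.u021`: under the simplicity of the zeros of `L(s,ψ)L(s,ψχ)` in
`Ω` for `ψ ∈ Ψ₁` (`Skeleton.Prop22ii`), every `ρ ∈ 𝔷(ψ)` (a zero of `L(·,ψ)` inside `Ω`, tree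
`Skeleton.mem_prodZeroSetOmega_of_mem_zeroSet`) has `L′(ρ,ψ) ≠ 0`, whence
`M′(ρ,ψ) = Y(ρ,ψ)L′(ρ,ψ) ≠ 0` (tree `GammaFactor.deriv_M_ne_zero_of_simple_zero`). Kernel-checked.
[cite: Zhang2022LandauSiegel, §2 p.8] -/
theorem derivMAtZero_of_prop22ii (h : Prop22ii) : DerivMAtZero := by
  obtain ⟨D₀, hD₀⟩ := h
  refine ⟨max D₀ 3, fun D _ χ hD hq hp x hx ρ hρ => ?_⟩
  have hD3 : 3 ≤ D := le_trans (le_max_right _ _) hD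
  have him : 0 < ρ.im := im_pos_of_mem_zeroSet hD3 hρ
  have hρ1 : ρ ≠ 1 := fun h1 => by rw [h1] at him; simp at him
  have hsimple := hD₀ D χ (le_trans (le_max_left _ _) hD) hq hp x hx ρ
    (mem_prodZeroSetOmega_of_mem_zeroSet χ hρ)
  have hL1 : deriv x.ψ.LFunction ρ ≠ 0 := deriv_LFunction_ne_zero_of_simple χ hρ1 hρ.2.2 hsimple
  exact ⟨deriv_Mfun_eq_of_mem_zeroSet hD3 hρ,
    GammaFactor.deriv_M_ne_zero_of_simple_zero x.prim x.p_ne_one (Yroot_spec x.prim).1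
      (Yroot_spec x.prim).2 him hρ.2.2 hL1⟩

/-- **p. 8** (DAG `Z22:§2.u023`): "By (2.11) and (2.12) we have `𝔠*(ρ,ψ) ∈ ℝ`" for `ψ ∈ Ψ₁`,
`ρ ∈ 𝔷(ψ)`, `𝔠*(ρ,ψ) = −iM(ρ+β₁,ψ)M(ρ+β₂,ψ)M(ρ+β₃,ψ)/M′(ρ,ψ)` (`Skeleton.cstar c′`, the `β_j` of (2.13)
carrying the constant `c′`). Typed as `Im 𝔠*(ρ,ψ) = 0` under the standing quantifier. CLAIM — the
printed justification applies (2.11)–(2.12) at `ρ` and `ρ + β_j`, i.e. it silently places `ρ` on the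
critical line (Proposition 2.2 (i)); see the EDGE `cstarReal_of_prop22i`. (It is also the first
conjunct of the banked `Skeleton.Lemma23 c′`: `cstarReal_of_lemma23`.)
[cite: Zhang2022LandauSiegel, §2 p.8] -/
def CstarReal (c' : ℝ) : Prop :=
  ForAllLarge fun D _ χ => ∀ x ∈ PsiOne χ, ∀ ρ ∈ zeroSet D x, (cstar c' D x ρ).im = 0

/-- `Z22:§2.u023` is the reality conjunct of the banked node `Skeleton.Lemma23 c′`.
[cite: Zhang2022LandauSiegel, §2 Lemma 2.3 p.8] -/
theorem cstarReal_of_lemma23 {c' : ℝ} (h : Lemma23 c') : CstarReal c' := by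
  obtain ⟨D₀, hD₀⟩ := h
  exact ⟨D₀, fun D _ χ hD hq hp x hx ρ hρ => (hD₀ D χ hD hq hp x hx ρ hρ).1⟩

/-- `log P = 𝓛⁹`, so `α = π/𝓛⁹` (2.10). [cite: Zhang2022LandauSiegel, §2 (2.10) p.6] -/
theorem alpha_eq_pi_div_ell9 (D : ℕ) : alpha D = π / ell D ^ 9 := by
  rw [alpha, bigP, Real.log_exp]

/-- For `D ≥ 3`: `0 < α ≤ π` and `0 < α𝓛 ≤ π` (`𝓛 > 1`). [cite: Zhang2022LandauSiegel, §2 (2.10) p.6] -/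
theorem alpha_pos_le_pi {D : ℕ} (hD : 3 ≤ D) :
    0 < alpha D ∧ alpha D ≤ π ∧ alpha D * ell D ≤ π := by
  have h1 : 1 < ell D := one_lt_ell hD
  have h0 : 0 < ell D := by linarith
  have h9 : 1 ≤ ell D ^ 9 := one_le_pow₀ h1.le
  have h8 : 1 ≤ ell D ^ 8 := one_le_pow₀ h1.le
  rw [alpha_eq_pi_div_ell9]
  refine ⟨by positivity, div_le_self Real.pi_pos.le h9, ?_⟩
  have hℓ : ell D ≠ 0 := h0.ne'
  have e : π / ell D ^ 9 * ell D = π / ell D ^ 8 := by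
    field_simp
  calc π / ell D ^ 9 * ell D = π / ell D ^ 8 := e
    _ ≤ π := div_le_self Real.pi_pos.le h8

/-- The shifts `β_j` of (2.13) are purely imaginary: `β_j = i·v_j` with
`v₁ = α(1 − 5c′α𝓛)`, `v₂ = 2α(1 + c′α𝓛)`, `v₃ = 3α(1 − c′α𝓛)`. [cite: Zhang2022LandauSiegel, §2 (2.13) p.7] -/
theorem beta123_eq_mul_I (c' : ℝ) (D : ℕ) :
    beta1 c' D = ((alpha D * (1 - 5 * c' * alpha D * ell D) : ℝ) : ℂ) * I ∧
      beta2 c' D = ((2 * alpha D * (1 + c' * alpha D * ell D) : ℝ) : ℂ) * I ∧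
        beta3 c' D = ((3 * alpha D * (1 - c' * alpha D * ell D) : ℝ) : ℂ) * I := by
  refine ⟨?_, ?_, ?_⟩
  · rw [beta1]; push_cast; ring
  · rw [beta2]; push_cast; ring
  · rw [beta3]; push_cast; ring

/-- The three real shifts are bounded in terms of `c′` alone once `D ≥ 3`:
`|v_j| ≤ 3π(1 + 5|c′|π)`. [cite: Zhang2022LandauSiegel, §2 (2.13) p.7] -/
theorem beta123_shift_abs_le {D : ℕ} (hD : 3 ≤ D) (c' : ℝ) (k a : ℝ) (hk : |k| ≤ 3) (ha : |a| ≤ 5) :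
    |k * alpha D * (1 + a * c' * alpha D * ell D)| ≤ 3 * π * (1 + 5 * |c'| * π) := by
  obtain ⟨hα, hαπ, hαℓ⟩ := alpha_pos_le_pi hD
  have hαℓ0 : 0 ≤ alpha D * ell D := le_of_lt (mul_pos hα (by linarith [one_lt_ell hD]))
  rw [abs_mul, abs_mul, abs_of_pos hα]
  have h1 : |1 + a * c' * alpha D * ell D| ≤ 1 + 5 * |c'| * π := by
    have e : a * c' * alpha D * ell D = (a * c') * (alpha D * ell D) := by ring
    rw [e]
    calc |1 + a * c' * (alpha D * ell D)| ≤ |(1 : ℝ)| + |a * c' * (alpha D * ell D)| :=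
          abs_add_le _ _
      _ = 1 + |a| * |c'| * (alpha D * ell D) := by
          rw [abs_one, abs_mul (a * c'), abs_mul a c', abs_of_nonneg hαℓ0]
      _ ≤ 1 + 5 * |c'| * π := by
          have := mul_le_mul (mul_le_mul_of_nonneg_right ha (abs_nonneg c')) hαℓ hαℓ0
            (by positivity)
          linarith
  have hkα : |k| * alpha D ≤ 3 * π := mul_le_mul hk hαπ hα.le (by norm_num)
  exact mul_le_mul hkα h1 (abs_nonneg _) (by positivity)

/-- Points of `𝔷(ψ)` have imaginary part `> 𝓛` for `D ≥ 3` (`γ > 2πt₀ − 𝓛₁ = 2π𝓛⁵¹⁹ − 𝓛⁴⁰⁵`).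
[cite: Zhang2022LandauSiegel, §2 (2.14) p.8] -/
theorem ell_lt_im_of_mem_zeroSet {D : ℕ} (hD : 3 ≤ D) {x : Chr D} {ρ : ℂ}
    (h : ρ ∈ zeroSet D x) : ell D < ρ.im := by
  obtain ⟨-, him, -⟩ := h
  have h1 : 1 < ell D := one_lt_ell hD
  have h405 : ell D ≤ ell1 D := by
    rw [ell1]; exact le_self_pow₀ h1.le (by norm_num)
  have hmono : ell1 D ≤ t0 D := pow_le_pow_right₀ h1.le (by norm_num)
  have hπ : (3 : ℝ) < π := Real.pi_gt_three
  have := (abs_lt.mp him).1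
  nlinarith

/-- **EDGE** `Prop. 2.2 (i) ⇒ Z22:§2.u023`: if the zeros of `L(s,ψ)L(s,ψχ)` in `Ω` (`ψ ∈ Ψ₁`) lie on the
critical line (`Skeleton.Prop22i`), then for `ρ = ½ + iγ ∈ 𝔷(ψ)` the shifted points `ρ + β_j = ½ +
i(γ + v_j)` stay on the line with `γ + v_j > 0` for large `D` (`γ > 𝓛`, `|v_j| ≤ 3π(1 + 5|c′|π)`), and
(2.11)–(2.12) give `𝔠*(ρ,ψ) ∈ ℝ` — the tree's `GammaFactor.calCstar_im_eq_zero`. Kernel-checked, for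
every real `c′`. [cite: Zhang2022LandauSiegel, §2 p.8] -/
theorem cstarReal_of_prop22i (c' : ℝ) (h : Prop22i) : CstarReal c' := by
  obtain ⟨D₀, hD₀⟩ := h
  -- `D` large enough that `𝓛 = log D ≥ V + 1`, `V` the uniform bound on the shifts
  set V : ℝ := 3 * π * (1 + 5 * |c'| * π) with hV
  refine ⟨max (max D₀ 3) ⌈Real.exp (V + 1)⌉₊, fun D _ χ hD hq hp x hx ρ hρ => ?_⟩
  have hD03 : max D₀ 3 ≤ D := le_trans (le_max_left _ _) hD
  have hD3 : 3 ≤ D := le_trans (le_max_right _ _) hD03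
  have hDV : ⌈Real.exp (V + 1)⌉₊ ≤ D := le_trans (le_max_right _ _) hD
  have hlog : V + 1 ≤ ell D := by
    have h : Real.exp (V + 1) ≤ D := le_trans (Nat.le_ceil _) (by exact_mod_cast hDV)
    exact (Real.le_log_iff_exp_le (lt_of_lt_of_le (Real.exp_pos _) h)).mpr h
  -- `ρ` is on the critical line by Prop. 2.2 (i)
  have hre : ρ.re = 1 / 2 :=
    hD₀ D χ (le_trans (le_max_left _ _) hD03) hq hp x hx ρ (mem_prodZeroSetOmega_of_mem_zeroSet χ hρ)
  have hγ : ell D < ρ.im := ell_lt_im_of_mem_zeroSet hD3 hρ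
  set γ : ℝ := ρ.im with hγdef
  have hρeq : ρ = 1 / 2 + (γ : ℂ) * I := Complex.ext (by simp [hre]) (by simp [hγdef])
  -- the three real shifts
  obtain ⟨hb₁, hb₂, hb₃⟩ := beta123_eq_mul_I c' D
  set v₁ : ℝ := alpha D * (1 - 5 * c' * alpha D * ell D) with hv₁
  set v₂ : ℝ := 2 * alpha D * (1 + c' * alpha D * ell D) with hv₂
  set v₃ : ℝ := 3 * alpha D * (1 - c' * alpha D * ell D) with hv₃
  have hav₁ : |v₁| ≤ V := by
    have := beta123_shift_abs_le hD3 c' 1 (-5) (by norm_num) (by norm_num)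
    rw [hv₁, hV]; convert this using 2; ring
  have hav₂ : |v₂| ≤ V := by
    have := beta123_shift_abs_le hD3 c' 2 1 (by norm_num) (by norm_num)
    rw [hv₂, hV]; convert this using 2; ring
  have hav₃ : |v₃| ≤ V := by
    have := beta123_shift_abs_le hD3 c' 3 (-1) (by norm_num) (by norm_num)
    rw [hv₃, hV]; convert this using 2; ring
  have hγ0 : 0 < γ := lt_trans (by linarith [one_lt_ell hD3]) hγ
  have h₁ : 0 < γ + v₁ := by have := (abs_le.mp hav₁).1; linarith
  have h₂ : 0 < γ + v₂ := by have := (abs_le.mp hav₂).1; linarith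
  have h₃ : 0 < γ + v₃ := by have := (abs_le.mp hav₃).1; linarith
  have key := GammaFactor.calCstar_im_eq_zero x.prim x.p_ne_one (Yroot_spec x.prim).1
    (Yroot_spec x.prim).2 hγ0 h₁ h₂ h₃
  -- identify the printed expression with `𝔠*(ρ,ψ)`
  have e₁ : ρ + beta1 c' D = 1 / 2 + ((γ + v₁ : ℝ) : ℂ) * I := by
    rw [hρeq, hb₁]; push_cast; ring
  have e₂ : ρ + beta2 c' D = 1 / 2 + ((γ + v₂ : ℝ) : ℂ) * I := by
    rw [hρeq, hb₂]; push_cast; ring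
  have e₃ : ρ + beta3 c' D = 1 / 2 + ((γ + v₃ : ℝ) : ℂ) * I := by
    rw [hρeq, hb₃]; push_cast; ring
  have hc : cstar c' D x ρ =
      -I * ((Yroot x.ψ (1 / 2 + ((γ + v₁ : ℝ) : ℂ) * I) * x.ψ.LFunction (1 / 2 + ((γ + v₁ : ℝ) : ℂ) * I))
        * (Yroot x.ψ (1 / 2 + ((γ + v₂ : ℝ) : ℂ) * I) * x.ψ.LFunction (1 / 2 + ((γ + v₂ : ℝ) : ℂ) * I))
        * (Yroot x.ψ (1 / 2 + ((γ + v₃ : ℝ) : ℂ) * I) * x.ψ.LFunction (1 / 2 + ((γ + v₃ : ℝ) : ℂ) * I)))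
      / deriv (fun s => Yroot x.ψ s * x.ψ.LFunction s) (1 / 2 + γ * I) := by
    unfold cstar
    rw [e₁, e₂, e₃]
    unfold Mfun
    rw [hρeq]
    ring
  rw [hc]
  exact key

/-! ## The parameter identity of p. 6 (`Z22:§2.u013`) -/

/-- **`Z22:§2.u013` holds**: for `p ∼ P` one has `𝓛⁹ < log p ≤ 𝓛⁹ + 1` and
`log(Dp²t₀²) = 2𝓛⁹ + E` with `𝓛 ≤ E ≤ 1041𝓛` (`log t₀ = 519 log 𝓛 ≤ 519𝓛`), whence
`|2π/log(Dp²t₀²) − π/𝓛⁹| = πE/(log(Dp²t₀²)·𝓛⁹) ≤ (1041π/2)𝓛⁻¹⁷ = (1041/2π)·α²𝓛` for `D ≥ 3`.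
[cite: Zhang2022LandauSiegel, §2 p.6 (before (2.10))] -/
theorem gapParam_holds : GapParam := by
  refine ⟨1041 / (2 * π), 3, fun D hD p hp => ?_⟩
  have h1 : 1 < ell D := one_lt_ell hD
  have hℓ0 : 0 < ell D := by linarith
  -- the prime `p ∼ P`: `P < p < P(1 + 𝓛⁻⁶⁸)`
  obtain ⟨hpI, -⟩ := Finset.mem_filter.mp hp
  obtain ⟨hlo, hhi⟩ := Finset.mem_Ioo.mp hpI
  have hP0 : 0 < bigP D := Real.exp_pos _
  have hPp : bigP D < p := (Nat.floor_lt hP0.le).mp hlo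
  have hpQ : (p : ℝ) < bigP D * (1 + (ell D ^ 68)⁻¹) := Nat.lt_ceil.mp hhi
  have hp0 : (0 : ℝ) < p := lt_trans hP0 hPp
  have hlogP : Real.log (bigP D) = ell D ^ 9 := by rw [bigP, Real.log_exp]
  have hlogp_lo : ell D ^ 9 < Real.log p := by
    rw [← hlogP]; exact Real.log_lt_log hP0 hPp
  have h68 : (ell D ^ 68)⁻¹ ≤ 1 := (inv_le_one₀ (pow_pos hℓ0 68)).mpr (one_le_pow₀ h1.le)
  have hlogp_hi : Real.log p ≤ ell D ^ 9 + 1 := by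
    have h1Q : 0 < 1 + (ell D ^ 68)⁻¹ := by positivity
    have hlog1 : Real.log (1 + (ell D ^ 68)⁻¹) ≤ (ell D ^ 68)⁻¹ := by
      have := Real.log_le_sub_one_of_pos h1Q
      linarith
    calc Real.log p ≤ Real.log (bigP D * (1 + (ell D ^ 68)⁻¹)) := Real.log_le_log hp0 hpQ.le
      _ = ell D ^ 9 + Real.log (1 + (ell D ^ 68)⁻¹) := by rw [Real.log_mul hP0.ne' h1Q.ne', hlogP]
      _ ≤ ell D ^ 9 + 1 := by linarith
  -- `log t₀ = 519 log 𝓛`, `0 ≤ log 𝓛 ≤ 𝓛`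
  have ht0 : Real.log (t0 D) = 519 * Real.log (ell D) := by
    rw [t0, Real.log_pow]; push_cast; ring
  have hlogℓ0 : 0 ≤ Real.log (ell D) := Real.log_nonneg h1.le
  have hlogℓ : Real.log (ell D) ≤ ell D := by
    have := Real.log_le_sub_one_of_pos hℓ0
    linarith
  -- `X = log(Dp²t₀²) = 𝓛 + 2 log p + 2·519 log 𝓛`
  have hD0 : (0 : ℝ) < D := by exact_mod_cast (show 0 < D by omega)
  have ht00 : 0 < t0 D := by rw [t0]; positivity
  have hX : Real.log ((D : ℝ) * (p : ℝ) ^ 2 * t0 D ^ 2) =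
      ell D + 2 * Real.log p + 2 * (519 * Real.log (ell D)) := by
    rw [Real.log_mul (mul_pos hD0 (pow_pos hp0 2)).ne' (pow_pos ht00 2).ne',
      Real.log_mul hD0.ne' (pow_pos hp0 2).ne', Real.log_pow, Real.log_pow, ht0]
    simp only [ell]
    push_cast
    ring
  set X := Real.log ((D : ℝ) * (p : ℝ) ^ 2 * t0 D ^ 2) with hXdef
  have hE_lo : ell D ≤ X - 2 * ell D ^ 9 := by rw [hX]; linarith
  have hE_hi : X - 2 * ell D ^ 9 ≤ 1041 * ell D := by rw [hX]; linarith
  have hℓ9 : 0 < ell D ^ 9 := pow_pos hℓ0 9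
  have hX_lo : 2 * ell D ^ 9 ≤ X := by linarith
  have hXpos : 0 < X := by linarith
  rw [alpha_eq_pi_div_ell9, abs_sub_comm]
  have key : π / ell D ^ 9 - 2 * π / X = π * (X - 2 * ell D ^ 9) / (X * ell D ^ 9) := by
    field_simp
  have hEnn : 0 ≤ X - 2 * ell D ^ 9 := by linarith
  rw [key, abs_of_nonneg (div_nonneg (mul_nonneg Real.pi_pos.le hEnn) (mul_pos hXpos hℓ9).le)]
  calc π * (X - 2 * ell D ^ 9) / (X * ell D ^ 9)
      ≤ π * (1041 * ell D) / (2 * ell D ^ 9 * ell D ^ 9) := by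
        gcongr
    _ = 1041 / (2 * π) * (π / ell D ^ 9) ^ 2 * ell D := by
        field_simp

/-- `GapParam` — `_holds` alias of `gapParam_holds` above under the fact's exact name (appended
2026-08-28, D-0026 bookkeeping: the proof term is the existing theorem of this file; no statement,
definition or attribute is edited; no new named fact; the ledger's debt table listed the fact
unproved). [cite: Zhang2022LandauSiegel, §2 p.6 (before (2.10))] -/
theorem _root_.Literature.NumberTheory.LFunctions.Zhang2022.Section2.GapParam_holds : GapParam :=
  _root_.Literature.NumberTheory.LFunctions.Zhang2022.Section2.gapParam_holds

end Literature.NumberTheory.LFunctions.Zhang2022.Section2
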